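import Mathlib
import HarnessLib
import Summits.Parity.GeneralizedHardyLittlewood.Theses.LiouvilleMAD
import Summits.Parity.GeneralizedHardyLittlewood.Theorems.LiouvilleMADDecorrelationToDilatedChowla
import Summits.Parity.GeneralizedHardyLittlewood.Theorems.DilatedChowla.Negative.DilatedChowlaMirror

/-!
# `FanDecorrelation` (stmt-Parity-13318): the MAD pair is jointly Landau–Siegel-hard

Hardness certificate for the crux `LiouvilleMAD.FanDecorrelation` (route LiouvilleMAD, rank 3), by the
line lead c4 (line `SketchIdeator5`).  The route's two decorrelation cruxes — `CosetDecorrelation`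
(stmt-Parity-13317, rank 2) and `FanDecorrelation` (stmt-Parity-13318, rank 3) — together give the rank-4
crux `DilatedChowla` by the PROVED glue `decorrelationToDilatedChowla_proof` (stmt-Parity-13321,
DivisorSwitch), and `DilatedChowla` implies, by the sibling crux's PROVED Siegel mirror
(`Theorems/DilatedChowla/Negative/DilatedChowlaMirror`: Landau's method with the poles `s = 1, β`,
orthogonality, Gram positivity in the dilation variable), a REAL-ZERO-FREE INTERVAL
`[1 − 1/(C₀ log² q), 1)` for every primitive quadratic Dirichlet `L`-function of conductor `q ≥ q₀`.
Unconditionally only Siegel's ineffective `1 − β ≥ C(ε) q^{−ε}` is known, so: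

* `realZeroFree_of_MAD`: `CosetDecorrelation → FanDecorrelation → ∃ C₀ > 0, ∃ q₀, …, L(σ, χ) ≠ 0` on
  `[1 − 1/(C₀ log² q), 1)` — no proof of the MAD pair is cheaper than an effective Landau–Siegel
  theorem of that quality (route `why_might_fail`, "Siegel caricature", made a kernel-checked
  implication).
* `FanDecorrelation_false_of_siegelZerosAbove_of_coset`: the same in `_false_of_` form — Siegel zeros
  of EVERY logarithmic quality at arbitrarily large conductors (`SiegelZerosAbove`, believed false: a
  hardness certificate, not a refutation mechanism), together with `CosetDecorrelation`, refute the crux.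

No definitions are declared; both statements are compositions of landed theorems. [folklore]
-/

noncomputable section

namespace Summit.Parity.GeneralizedHardyLittlewood.Theorems.FanDecorrelation.Negative

open Summit.Parity.GeneralizedHardyLittlewood.Theses.LiouvilleMAD
open Summit.Parity.GeneralizedHardyLittlewood.Theorems.DilatedChowla.Negative
  (SiegelZerosAbove siegelMirror_realZeroFree DilatedChowla_false_of_siegelZerosAbove)

/-- **The MAD pair is jointly Landau–Siegel-hard.**  `CosetDecorrelation` and `FanDecorrelation`
together imply a real-zero-free interval `[1 − 1/(C₀ log² q), 1)` for every primitive quadratic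
`L(s, χ mod q)`, `q ≥ q₀` (via `DilatedChowla` and its Siegel mirror). [folklore] -/
theorem realZeroFree_of_MAD (h₁ : CosetDecorrelation) (h₂ : FanDecorrelation) :
    ∃ C₀ : ℝ, 0 < C₀ ∧ ∃ q₀ : ℕ, ∀ (q : ℕ) [NeZero q] (χ : DirichletCharacter ℂ q),
      χ.IsPrimitive → χ.IsQuadratic → q₀ ≤ q →
        ∀ σ : ℝ, 1 - 1 / (C₀ * Real.log q ^ 2) ≤ σ → σ < 1 → χ.LFunction (σ : ℂ) ≠ 0 :=
  siegelMirror_realZeroFree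
    ((show CosetDecorrelation → FanDecorrelation → DilatedChowla from
      Summit.Parity.GeneralizedHardyLittlewood.Theorems.decorrelationToDilatedChowla_proof) h₁ h₂)

/-- `_false_of_` form: Siegel zeros of every logarithmic quality at arbitrarily large conductors,
together with `CosetDecorrelation`, refute `FanDecorrelation`.  (Hardness certificate: the hypothesis
`hz` is believed false.) [folklore] -/
theorem FanDecorrelation_false_of_siegelZerosAbove_of_coset
    (hz : ∀ C₀ : ℝ, 0 < C₀ → SiegelZerosAbove (fun q => C₀ * Real.log q))
    (h₁ : CosetDecorrelation) : ¬ FanDecorrelation := fun h₂ =>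
  DilatedChowla_false_of_siegelZerosAbove hz
    ((show CosetDecorrelation → FanDecorrelation → DilatedChowla from
      Summit.Parity.GeneralizedHardyLittlewood.Theorems.decorrelationToDilatedChowla_proof) h₁ h₂)

end Summit.Parity.GeneralizedHardyLittlewood.Theorems.FanDecorrelation.Negative

end
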